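import Mathlib
import Literature.Probability.RandomPlanarGeometry.ConformalRestrictionProofs
import HarnessLib

/-!
# Holomorphy off the trace is a Borel condition (stub T2a of crux `RemovableLimit`)

Route `SAWWeldingIdentification`, crux stmt-CriticalPhenomena-4503 `RemovableLimit`, line
`registered` (skeleton v3), stub `stub_measurableSet_differentiableOn`.

For an open `Ω ⊆ ℂ` give the function space `C(Ω, ℂ)` (compact-open topology) a Borel
σ-algebra, and for `g ∈ C(Ω, ℂ)` write `ĝ = Function.extend Subtype.val g 0 : ℂ → ℂ` (`ĝ = g` on
`Ω`, `0` off `Ω`). We prove that `{(γ, g) | ĝ holomorphic on Ω ∖ γ.range}` is Borel in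
`CurveClass ℂ × C(Ω, ℂ)` and `{g | ĝ holomorphic on Ω}` is Borel in `C(Ω, ℂ)`.

## Proof

Holomorphy of `ĝ` on an open `U ⊆ Ω` is equivalent to: for every closed disc `closedBall c R ⊆ U`
with `c` in a fixed countable dense set and `R` rational, and every `m`, there is `h ∈ C(Ω, ℂ)` with
`ĥ` holomorphic on `ball c R` and `‖g - h‖ < 1/(m+1)` on `closedBall c (R/2)`
(`differentiableOn_extend_iff`; "⇒" with `h = g`, "⇐" because a uniform limit of holomorphic
functions is holomorphic, `TendstoLocallyUniformlyOn.differentiableOn`, and the half-discs cover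
`U`). For fixed `(c, R, m, h)` the approximation condition is OPEN in `g` (compact-open topology:
`ContinuousMap.isOpen_setOf_mapsTo` after translating by `h`), and "`closedBall c R` misses
`γ.range`" is open in `γ` (`CurveClass.isOpen_rangeSubset`); countable intersections conclude.
-/

open MeasureTheory Filter Set Topology Metric
open Literature.Probability.RandomPlanarGeometry

namespace Summit.CriticalPhenomena.SAWScalingLimit.Theorems.RemovableLimit

/-- The extension by zero of `g ∈ C(Ω, ℂ)` agrees with `g` on `Ω`. [folklore] -/
theorem extend_val_apply {Ω : Set ℂ} (g : C(Ω, ℂ)) {z : ℂ} (hz : z ∈ Ω) :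
    Function.extend Subtype.val (⇑g) 0 z = g ⟨z, hz⟩ := by
  have := Subtype.val_injective.extend_apply (⇑g) (0 : ℂ → ℂ) ⟨z, hz⟩
  simpa using this

/-- **Small discs with centres in a dense set reach every point of an open set**: for `z ∈ U`,
`U` open and `S` dense there are `c ∈ S` and a rational `R > 0` with `closedBall c R ⊆ U` and
`z ∈ ball c (R / 2)`. [folklore] -/
theorem exists_disc_of_mem_open {S U : Set ℂ} (hS : Dense S) (hU : IsOpen U) {z : ℂ} (hz : z ∈ U) :
    ∃ c ∈ S, ∃ R : ℚ, 0 < R ∧ closedBall c R ⊆ U ∧ z ∈ ball c ((R : ℝ) / 2) := by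
  obtain ⟨ρ, hρ, hball⟩ := Metric.isOpen_iff.1 hU z hz
  obtain ⟨R, hR0, hRρ⟩ := exists_rat_btwn (show (0 : ℝ) < ρ / 2 by positivity)
  have hR0' : (0 : ℚ) < R := by exact_mod_cast hR0
  obtain ⟨c, hcS, hcz⟩ := hS.exists_dist_lt z (show (0 : ℝ) < R / 2 by positivity)
  refine ⟨c, hcS, R, hR0', fun w hw => hball ?_, ?_⟩
  · rw [mem_closedBall] at hw
    rw [mem_ball]
    calc dist w z ≤ dist w c + dist c z := dist_triangle _ _ _
      _ < R + R / 2 := by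
          have : dist c z < R / 2 := by rwa [dist_comm] at hcz
          linarith
      _ < ρ := by linarith
  · rw [mem_ball]
    exact hcz

/-- **Openness of uniform approximation on a compact set.** For `K ⊆ Ω` compact,
`h ∈ C(Ω, ℂ)` and `ε`, the set of `g ∈ C(Ω, ℂ)` with `‖g w - h w‖ < ε` for all `w ∈ K` is open in
the compact-open topology (it is the translate by `h` of the subbasic open set of maps sending the
compact `K` into the open ball `ball 0 ε`). [folklore] -/
theorem isOpen_setOf_norm_sub_lt {Ω : Set ℂ} {K : Set ℂ} (hK : IsCompact K)
    (hKΩ : K ⊆ Ω) (h : C(Ω, ℂ)) (ε : ℝ) :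
    IsOpen {g : C(Ω, ℂ) | ∀ w : Ω, (w : ℂ) ∈ K → ‖g w - h w‖ < ε} := by
  -- the compact `K`, seen inside `Ω`
  have hK' : IsCompact ((Subtype.val : Ω → ℂ) ⁻¹' K) := by
    rw [Subtype.isCompact_iff, Subtype.image_preimage_coe, inter_eq_right.2 hKΩ]
    exact hK
  have hopen : IsOpen {f : C(Ω, ℂ) | MapsTo f ((Subtype.val : Ω → ℂ) ⁻¹' K) (ball (0 : ℂ) ε)} :=
    ContinuousMap.isOpen_setOf_mapsTo hK' isOpen_ball
  have hcont : Continuous fun g : C(Ω, ℂ) => g - h := continuous_id.sub continuous_const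
  have heq : {g : C(Ω, ℂ) | ∀ w : Ω, (w : ℂ) ∈ K → ‖g w - h w‖ < ε} =
      (fun g : C(Ω, ℂ) => g - h) ⁻¹'
        {f : C(Ω, ℂ) | MapsTo f ((Subtype.val : Ω → ℂ) ⁻¹' K) (ball (0 : ℂ) ε)} := by
    ext g
    simp only [mem_setOf_eq, mem_preimage, MapsTo, ContinuousMap.sub_apply, mem_ball_zero_iff,
      Subtype.forall]
  rw [heq]
  exact hopen.preimage hcont

/-- **Holomorphy of the extension is a countable conjunction of approximation conditions.** Let
`Ω` be open, `U ⊆ Ω` open, `S ⊆ ℂ` dense and `g ∈ C(Ω, ℂ)`. Then `ĝ = Function.extend Subtype.val g 0`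
is holomorphic on `U` iff for every `c ∈ S`, rational `R > 0` with `closedBall c R ⊆ U` and every
`m : ℕ` there is `h ∈ C(Ω, ℂ)` with `ĥ` holomorphic on `ball c R` and `‖g - h‖ < 1/(m+1)` on
`closedBall c (R/2)`. ("⇒": `h = g`. "⇐": on `ball c (R/2)`, `ĝ` is a uniform limit of the
holomorphic `ĥ_m`, hence holomorphic, `TendstoLocallyUniformlyOn.differentiableOn`; such half-discs
cover `U`.) [folklore] -/
theorem differentiableOn_extend_iff {Ω U S : Set ℂ} (hU : IsOpen U) (hUΩ : U ⊆ Ω) (hS : Dense S)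
    (g : C(Ω, ℂ)) :
    DifferentiableOn ℂ (Function.extend Subtype.val (⇑g) 0) U ↔
      ∀ c ∈ S, ∀ R : ℚ, 0 < R → closedBall c R ⊆ U → ∀ m : ℕ, ∃ h : C(Ω, ℂ),
        DifferentiableOn ℂ (Function.extend Subtype.val (⇑h) 0) (ball c R) ∧
          ∀ w : Ω, (w : ℂ) ∈ closedBall c ((R : ℝ) / 2) → ‖g w - h w‖ < 1 / ((m : ℝ) + 1) := by
  constructor
  · intro hg c _ R _ hsub m
    refine ⟨g, hg.mono (ball_subset_closedBall.trans hsub), fun w _ => ?_⟩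
    rw [sub_self, norm_zero]
    positivity
  · intro H z hz
    obtain ⟨c, hcS, R, hR0, hsub, hzc⟩ := exists_disc_of_mem_open hS hU hz
    choose h hh using H c hcS R hR0 hsub
    have hR0' : (0 : ℝ) < R := by exact_mod_cast hR0
    -- the half-disc lies in `Ω`
    have hhalf : ball c ((R : ℝ) / 2) ⊆ closedBall c ((R : ℝ) / 2) := ball_subset_closedBall
    have hhalfU : closedBall c ((R : ℝ) / 2) ⊆ closedBall c R :=
      closedBall_subset_closedBall (by linarith)
    have hballΩ : ball c ((R : ℝ) / 2) ⊆ Ω :=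
      hhalf.trans (hhalfU.trans (hsub.trans hUΩ))
    -- uniform convergence `ĥ_m → ĝ` on the half-disc
    have hunif : TendstoUniformlyOn (fun m w => Function.extend Subtype.val (⇑(h m)) 0 w)
        (Function.extend Subtype.val (⇑g) 0) atTop (ball c ((R : ℝ) / 2)) := by
      rw [Metric.tendstoUniformlyOn_iff]
      intro ε hε
      obtain ⟨N, hN⟩ := exists_nat_one_div_lt hε
      refine eventually_atTop.2 ⟨N, fun m hm w hw => ?_⟩
      have hwΩ : w ∈ Ω := hballΩ hw
      rw [dist_eq_norm, extend_val_apply g hwΩ, extend_val_apply (h m) hwΩ]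
      have h1 := (hh m).2 ⟨w, hwΩ⟩ (hhalf hw)
      have h2 : 1 / ((m : ℝ) + 1) ≤ 1 / ((N : ℝ) + 1) := by
        apply one_div_le_one_div_of_le
        · positivity
        · exact_mod_cast Nat.succ_le_succ hm
      linarith
    have hdiff : DifferentiableOn ℂ (Function.extend Subtype.val (⇑g) 0) (ball c ((R : ℝ) / 2)) :=
      hunif.tendstoLocallyUniformlyOn.differentiableOn
        (Eventually.of_forall fun m => (hh m).1.mono (ball_subset_ball (by linarith))) isOpen_ball
    exact (hdiff.differentiableAt (isOpen_ball.mem_nhds hzc)).differentiableWithinAt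

/-- **The approximation event is open.** For `closedBall c R ⊆ Ω` and `m : ℕ`, the set of
`g ∈ C(Ω, ℂ)` admitting `h ∈ C(Ω, ℂ)` with `ĥ` holomorphic on `ball c R` and `‖g - h‖ < 1/(m+1)` on
`closedBall c (R/2)` is open (a union over `h` of open sets, `isOpen_setOf_norm_sub_lt`).
[folklore] -/
theorem isOpen_setOf_exists_approx {Ω : Set ℂ} {c : ℂ} {R : ℝ}
    (hsub : closedBall c R ⊆ Ω) (m : ℕ) :
    IsOpen {g : C(Ω, ℂ) | ∃ h : C(Ω, ℂ),
      DifferentiableOn ℂ (Function.extend Subtype.val (⇑h) 0) (ball c R) ∧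
        ∀ w : Ω, (w : ℂ) ∈ closedBall c (R / 2) → ‖g w - h w‖ < 1 / ((m : ℝ) + 1)} := by
  have heq : {g : C(Ω, ℂ) | ∃ h : C(Ω, ℂ),
      DifferentiableOn ℂ (Function.extend Subtype.val (⇑h) 0) (ball c R) ∧
        ∀ w : Ω, (w : ℂ) ∈ closedBall c (R / 2) → ‖g w - h w‖ < 1 / ((m : ℝ) + 1)} =
      ⋃ h ∈ {h : C(Ω, ℂ) | DifferentiableOn ℂ (Function.extend Subtype.val (⇑h) 0) (ball c R)},
        {g : C(Ω, ℂ) | ∀ w : Ω, (w : ℂ) ∈ closedBall c (R / 2) → ‖g w - h w‖ < 1 / ((m : ℝ) + 1)} := by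
    ext g
    simp only [mem_setOf_eq, mem_iUnion, exists_prop]
  rw [heq]
  refine isOpen_biUnion fun h _ => ?_
  by_cases hR : 0 ≤ R
  · exact isOpen_setOf_norm_sub_lt (isCompact_closedBall c (R / 2))
      ((closedBall_subset_closedBall (by linarith)).trans hsub) h _
  · -- degenerate radius: the condition is vacuous
    have hempty : closedBall c (R / 2) = ∅ := closedBall_eq_empty.2 (by linarith)
    have : {g : C(Ω, ℂ) | ∀ w : Ω, (w : ℂ) ∈ closedBall c (R / 2) → ‖g w - h w‖ < 1 / ((m : ℝ) + 1)}
        = univ := by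
      refine eq_univ_of_forall fun g w hw => ?_
      rw [hempty] at hw
      exact absurd hw (notMem_empty _)
    rw [this]
    exact isOpen_univ

/-- **Holomorphy off the trace is a Borel condition** (stub T2a of crux stmt-CriticalPhenomena-4503,
line `registered`). Let `Ω ⊆ ℂ` be open and give `C(Ω, ℂ)` (compact-open topology) a Borel
σ-algebra; write `ĝ = Function.extend Subtype.val g 0`. Then `{(γ, g) | ĝ holomorphic on Ω ∖ γ.range}`
is Borel in `CurveClass ℂ × C(Ω, ℂ)` and `{g | ĝ holomorphic on Ω}` is Borel in `C(Ω, ℂ)`: by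
`differentiableOn_extend_iff` both are countable intersections, over discs `closedBall c R ⊆ Ω`
(`c` in a countable dense set, `R ∈ ℚ`) and `m : ℕ`, of the open approximation events
(`isOpen_setOf_exists_approx`), joined in the first case with the closed event
"`closedBall c R` meets `γ.range`" (`CurveClass.isOpen_rangeSubset`). [folklore] -/
theorem stub_measurableSet_differentiableOn {Ω : Set ℂ} (hΩ : IsOpen Ω)
    [MeasurableSpace C(Ω, ℂ)] [BorelSpace C(Ω, ℂ)] :
    MeasurableSet {p : CurveClass ℂ × C(Ω, ℂ) |
        DifferentiableOn ℂ (Function.extend Subtype.val (⇑p.2) 0) (Ω \ p.1.range)} ∧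
      MeasurableSet {g : C(Ω, ℂ) | DifferentiableOn ℂ (Function.extend Subtype.val (⇑g) 0) Ω} := by
  obtain ⟨S, hSc, hSd⟩ := TopologicalSpace.exists_countable_dense ℂ
  -- the approximation events and their measurability
  have hA : ∀ (c : ℂ) (R : ℚ) (m : ℕ), closedBall c R ⊆ Ω →
      MeasurableSet {g : C(Ω, ℂ) | ∃ h : C(Ω, ℂ),
        DifferentiableOn ℂ (Function.extend Subtype.val (⇑h) 0) (ball c R) ∧
          ∀ w : Ω, (w : ℂ) ∈ closedBall c ((R : ℝ) / 2) → ‖g w - h w‖ < 1 / ((m : ℝ) + 1)} :=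
    fun c R m hsub => (isOpen_setOf_exists_approx hsub m).measurableSet
  constructor
  · -- the joint event in `(γ, g)`
    have heq : {p : CurveClass ℂ × C(Ω, ℂ) |
        DifferentiableOn ℂ (Function.extend Subtype.val (⇑p.2) 0) (Ω \ p.1.range)} =
        ⋂ c ∈ S, ⋂ (R : ℚ) (m : ℕ), {p : CurveClass ℂ × C(Ω, ℂ) |
          0 < R → closedBall c R ⊆ Ω → p.1 ∈ CurveClass.rangeSubset (closedBall c R)ᶜ →
            p.2 ∈ {g : C(Ω, ℂ) | ∃ h : C(Ω, ℂ),
              DifferentiableOn ℂ (Function.extend Subtype.val (⇑h) 0) (ball c R) ∧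
                ∀ w : Ω, (w : ℂ) ∈ closedBall c ((R : ℝ) / 2) → ‖g w - h w‖ < 1 / ((m : ℝ) + 1)}} := by
      ext p
      have hUo : IsOpen (Ω \ p.1.range) := hΩ.sdiff (CurveClass.isCompact_range p.1).isClosed
      rw [mem_setOf_eq, differentiableOn_extend_iff hUo sdiff_subset hSd p.2]
      simp only [mem_iInter, mem_setOf_eq, CurveClass.mem_rangeSubset, subset_sdiff,
        subset_compl_iff_disjoint_left]
      constructor
      · intro H c hc R m hR hsub hdisj
        exact H c hc R hR ⟨hsub, hdisj⟩ m
      · intro H c hc R hR hsub m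
        exact H c hc R m hR hsub.1 hsub.2
    rw [heq]
    refine MeasurableSet.biInter hSc fun c _ => MeasurableSet.iInter fun R =>
      MeasurableSet.iInter fun m => ?_
    by_cases hR : (0 : ℚ) < R
    · by_cases hsub : closedBall c (R : ℝ) ⊆ Ω
      · have hmeas1 : MeasurableSet
            (Prod.fst ⁻¹' CurveClass.rangeSubset (closedBall c (R : ℝ))ᶜ :
              Set (CurveClass ℂ × C(Ω, ℂ))) :=
          measurable_fst (CurveClass.isOpen_rangeSubset isClosed_closedBall.isOpen_compl).measurableSet
        have hmeas2 : MeasurableSet (Prod.snd ⁻¹' {g : C(Ω, ℂ) | ∃ h : C(Ω, ℂ),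
            DifferentiableOn ℂ (Function.extend Subtype.val (⇑h) 0) (ball c R) ∧
              ∀ w : Ω, (w : ℂ) ∈ closedBall c ((R : ℝ) / 2) → ‖g w - h w‖ < 1 / ((m : ℝ) + 1)} :
              Set (CurveClass ℂ × C(Ω, ℂ))) :=
          measurable_snd (hA c R m hsub)
        have hset : {p : CurveClass ℂ × C(Ω, ℂ) |
            0 < R → closedBall c R ⊆ Ω → p.1 ∈ CurveClass.rangeSubset (closedBall c R)ᶜ →
              p.2 ∈ {g : C(Ω, ℂ) | ∃ h : C(Ω, ℂ),
                DifferentiableOn ℂ (Function.extend Subtype.val (⇑h) 0) (ball c R) ∧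
                  ∀ w : Ω, (w : ℂ) ∈ closedBall c ((R : ℝ) / 2) →
                    ‖g w - h w‖ < 1 / ((m : ℝ) + 1)}} =
            (Prod.fst ⁻¹' CurveClass.rangeSubset (closedBall c (R : ℝ))ᶜ)ᶜ ∪
              Prod.snd ⁻¹' {g : C(Ω, ℂ) | ∃ h : C(Ω, ℂ),
                DifferentiableOn ℂ (Function.extend Subtype.val (⇑h) 0) (ball c R) ∧
                  ∀ w : Ω, (w : ℂ) ∈ closedBall c ((R : ℝ) / 2) →
                    ‖g w - h w‖ < 1 / ((m : ℝ) + 1)} := by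
          ext p
          simp only [mem_setOf_eq, mem_union, mem_compl_iff, mem_preimage, hR, hsub, true_imp_iff]
          tauto
        rw [hset]
        exact hmeas1.compl.union hmeas2
      · convert MeasurableSet.univ
        exact eq_univ_of_forall fun p _ h => absurd h hsub
    · convert MeasurableSet.univ
      exact eq_univ_of_forall fun p h => absurd h hR
  · -- the event in `g` alone
    have heq : {g : C(Ω, ℂ) | DifferentiableOn ℂ (Function.extend Subtype.val (⇑g) 0) Ω} =
        ⋂ c ∈ S, ⋂ (R : ℚ) (m : ℕ), {g : C(Ω, ℂ) | 0 < R → closedBall c R ⊆ Ω →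
          g ∈ {g : C(Ω, ℂ) | ∃ h : C(Ω, ℂ),
            DifferentiableOn ℂ (Function.extend Subtype.val (⇑h) 0) (ball c R) ∧
              ∀ w : Ω, (w : ℂ) ∈ closedBall c ((R : ℝ) / 2) → ‖g w - h w‖ < 1 / ((m : ℝ) + 1)}} := by
      ext g
      rw [mem_setOf_eq, differentiableOn_extend_iff hΩ Subset.rfl hSd g]
      simp only [mem_iInter, mem_setOf_eq]
      constructor
      · intro H c hc R m hR hsub
        exact H c hc R hR hsub m
      · intro H c hc R hR hsub m
        exact H c hc R m hR hsub
    rw [heq]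
    refine MeasurableSet.biInter hSc fun c _ => MeasurableSet.iInter fun R =>
      MeasurableSet.iInter fun m => ?_
    by_cases hR : (0 : ℚ) < R
    · by_cases hsub : closedBall c (R : ℝ) ⊆ Ω
      · have hset : {g : C(Ω, ℂ) | 0 < R → closedBall c R ⊆ Ω →
            g ∈ {g : C(Ω, ℂ) | ∃ h : C(Ω, ℂ),
              DifferentiableOn ℂ (Function.extend Subtype.val (⇑h) 0) (ball c R) ∧
                ∀ w : Ω, (w : ℂ) ∈ closedBall c ((R : ℝ) / 2) → ‖g w - h w‖ < 1 / ((m : ℝ) + 1)}} =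
            {g : C(Ω, ℂ) | ∃ h : C(Ω, ℂ),
              DifferentiableOn ℂ (Function.extend Subtype.val (⇑h) 0) (ball c R) ∧
                ∀ w : Ω, (w : ℂ) ∈ closedBall c ((R : ℝ) / 2) → ‖g w - h w‖ < 1 / ((m : ℝ) + 1)} := by
          ext g
          simp only [mem_setOf_eq, hR, hsub, true_imp_iff]
        rw [hset]
        exact hA c R m hsub
      · convert MeasurableSet.univ
        exact eq_univ_of_forall fun g _ h => absurd h hsub
    · convert MeasurableSet.univ
      exact eq_univ_of_forall fun g h => absurd h hR

end Summit.CriticalPhenomena.SAWScalingLimit.Theorems.RemovableLimit
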